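import Summits.CriticalPhenomena.PercolationContinuityZ3.Theorems.Transplant.SkelConcAssemblyG
import Summits.CriticalPhenomena.PercolationContinuityZ3.Theorems.Transplant.SkelKitResiduesHab
import Summits.CriticalPhenomena.PercolationContinuityZ3.Theorems.Transplant.SkelConcInnerAcc
import Summits.CriticalPhenomena.PercolationContinuityZ3.Theorems.Transplant.SkelScales
import HarnessLib

/-!
# L7.3′ — the generic (D) PARTIAL CLOSURE at `Skel.cellGeomSG`, run-restricted HABITAT form:
# **`samePDropOfSkeletonConcLt_of_concSG_residuesRH`** — the node of record `SamePDropOfSkeletonConcLt` modulo the three instance residues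
# `Skel.RootOblT` (root probe, D8), `Skel.FaceOblR` (faces) and the PACKAGING-AGNOSTIC corridor residue `Skel.ReachOblRH` (any chain length
# `n ≤ nmaxC`, any habitat window graph `winGraphIn G Ω`; SkelKitResiduesHab), with ONE chain accuracy `δC := min_{n ≤ nmaxC} δUP Φ n 2⁻³⁵`
# serving every corridor-chain length — supersedes `samePDropOfSkeletonConcLt_of_concSG_residuesR` (SkelConcClosure), whose plain-window (C)
# residue is uninhabitable for `Skel.cellGeomSG` (SHEAR-SCOPE §2.6)

builds on p205010 (kernel theorem, internal audit signed; external expert review pending) — nothing in this file uses p205010.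
Status sentence (coordinator 2026-08-20T04:30Z): "θ(p_c) = 0 on ℤ^d, all d ≥ 2 — kernel-verified (Lean 4/Mathlib, standard axioms); internal adversarial
audit SIGNED 2026-08-20 04:29Z; external expert review pending."
Lane `prim-bschramm-*`, seat `prim-bschramm-stmt` (gen 7); helper file (`--supports stmt-CriticalPhenomena-4575`).
What the instance still owes, for handed p-free constants `K₀ δ δ₂ δr`, at a CENTRED skeleton (`Φ.φ t = 0`), `0 < p < 1`, `Φ.CylSubcritical p`:
`∃ δin m₀, 0 < δin ∧ ∀ msel M₀, (Step-I sizes) → ∃ S ⊆ [M₀, ∞), ∀ q ∈ [p/2, p], (inputs over Φ.types × S at accuracy δin hold at q) →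
Φ.CylSubcritical q → ∃ C Λ, Skel.WFS C Λ ∧ K₀ ≤ C.K ∧ Skel.RootOblT G 𝒮 Φ.Δ δr ∧ Skel.FaceOblR Φ 𝒮 FD Φ.Δ δ₂ ∧ Skel.ReachOblRH G 𝒮 FD Φ.Δ δ`
with `𝒮 := concSchemeSG Φ C t Λ q δ`, `FD := Skel.faceDataSG Φ C t Λ`.
* `SkelConc.δC Φ ε`, `δC_le_δUP` (`n ≤ nmaxC`), `δC_pos`, `δC_le_one`;
* **`samePDropOfSkeletonConcLt_of_concSG_residuesRH`**.
[cite: KozmaNitzan2024, §4 Theorem 6 (pp. 25–31); §1 p. 2 (approach 1)] [cite: GrimmettPercolation1999, §7.3 pp. 162, 169]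
-/

noncomputable section

open MeasureTheory ProbabilityTheory
open scoped ENNReal Classical

namespace Summit.CriticalPhenomena.PercolationContinuityZ3.Theorems

namespace Transplant

namespace SkelConc

open Literature.Probability.Percolation Literature.Probability.LatticeModels SimpleGraph KNCells KNLevels
open Literature.Probability.Percolation.GM (HOct)
open BoxProdZ2 (ConcRadiiG)

/-! ## §1 One chain accuracy for every corridor-chain length `n ≤ nmaxC` -/

section DeltaC

variable {V : Type} [DecidableEq V] [Countable V] {G : SimpleGraph V} [G.LocallyFinite] (Φ : PlanarSkeletonConc G)

/-- **The corridor-chain accuracy** `δC := min_{n ≤ nmaxC} δUP Φ n ε`: one accuracy below the chain accuracy of every admissible corridor-chain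
length (so the corridor residue may re-package its chain across the cube / corridor seam with any number `≤ nmaxC + 1` of steps). [this work] -/
def δC (ε : ℝ) : ℝ :=
  ((Finset.range (Skel.nmaxC + 1)).image fun n => δUP Φ n ε).min' ⟨δUP Φ 0 ε, Finset.mem_image.2 ⟨0, by simp, rfl⟩⟩

/-- `δC ≤ δUP n ε` for every `n ≤ nmaxC`. [folklore] -/
theorem δC_le_δUP (ε : ℝ) {n : ℕ} (hn : n ≤ Skel.nmaxC) : δC Φ ε ≤ δUP Φ n ε :=
  Finset.min'_le _ _ (Finset.mem_image.2 ⟨n, Finset.mem_range.2 (Nat.lt_succ_of_le hn), rfl⟩)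

/-- `0 < δC`. [folklore] -/
theorem δC_pos (ε : ℝ) : 0 < δC Φ ε := by
  unfold δC
  refine (Finset.lt_min'_iff _ _).2 fun y hy => ?_
  obtain ⟨n, -, rfl⟩ := Finset.mem_image.1 hy
  exact δUP_pos Φ n _

/-- `δC ≤ 1`. [folklore] -/
theorem δC_le_one (ε : ℝ) : δC Φ ε ≤ 1 := (δC_le_δUP Φ ε (Nat.zero_le _)).trans (δUP_le_one Φ 0 _)

/-- **The chain property of every length `n ≤ nmaxC` at the accuracy `δC`**, in every subgraph `G' ≤ G`, for every `q < 1`, delivering `1 - ε`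
(`δUP_spec` + `KitsAt.mono`). [cite: KozmaNitzan2024, §4 Lemma 12 (pp. 23–25)] -/
theorem δC_spec {ε : ℝ} (hε : 0 < ε) {n : ℕ} (hn : n ≤ Skel.nmaxC) {q : unitInterval} (hq1 : (q : ℝ) < 1)
    (G' : SimpleGraph V) [G'.LocallyFinite] (hG' : G' ≤ G) :
    ∀ (Wt : Sym2 V → unitInterval) (s : Fin (n + 1) → TStep G') (T' : Fin (n + 1) → Finset V) (η : ℝ),
      (∀ i : Fin (n + 1), (s i).L.o = (s 0).L.o) →
      (∀ i : Fin n, T' (Fin.castSucc i) ⊆ (s i.succ).L.X 0) →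
      (∀ i : Fin (n + 1), T' i ⊆ (s i).T) →
      (∀ i : Fin (n + 1), (s i).KitsAt Wt q Φ.Δ (δC Φ ε)) →
      η ≤ δC Φ ε / 2 →
      (∀ i : Fin (n + 1), (prodBernoulli Wt).real (⋃ t ∈ (s i).T \ T' i, openConn (s 0).L.o t) ≤ η) →
      1 - δC Φ ε < (prodBernoulli Wt).real (s 0).L.reachB →
        1 - ε < (prodBernoulli Wt).real (⋃ t ∈ T' (Fin.last n), openConn (s 0).L.o t) := by
  intro Wt s T' η ho hlink hsub hkits hη hexc hsrc
  have hle := δC_le_δUP Φ ε hn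
  exact δUP_spec Φ n hε q hq1 G' hG' Wt s T' η ho hlink hsub (fun i => (hkits i).mono hle) (hη.trans (by linarith)) hexc (by linarith)

end DeltaC

/-! ## §2 The partial closure, habitat form -/

/-- **THE GENERIC (D) PARTIAL CLOSURE, run-restricted habitat form**: the node of record from the three instance residues `Skel.RootOblT` (D8),
`Skel.FaceOblR`, `Skel.ReachOblRH` at the concentric scheme over the cell geometry of record (constants `K₀ δ δ₂ δr` handed p-free; input family
(A) discharged by Step I; centred skeletons). [cite: KozmaNitzan2024, §4 Theorem 6 (pp. 25–31); §1 p. 2 (approach 1)] -/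
theorem samePDropOfSkeletonConcLt_of_concSG_residuesRH
    (hres : ∀ (K₀ : ℕ) (δ δ₂ : ℝ) (δr : ℕ → ℝ), 0 < δ → δ ≤ 1 → 0 < δ₂ → δ₂ ≤ 1 → (∀ n, 0 < δr n ∧ δr n ≤ 1) →
      ∀ {V : Type} [DecidableEq V] [Countable V] (G : SimpleGraph V) [G.LocallyFinite] (Φ : PlanarSkeletonConc G),
        G.Connected → ∀ t ∈ Φ.types, Φ.φ t = 0 → ∀ (p : unitInterval), 0 < (p : ℝ) → (p : ℝ) < 1 →
          ∀ (hC : Φ.toPlanarSkeleton.CylSubcritical p),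
          ∃ (δin : ℝ) (m₀ : ℕ), 0 < δin ∧
            ∀ (msel : V → ℕ) (M₀ : ℕ), (∀ τ ∈ Φ.types, m₀ ≤ msel τ ∧ msel τ < M₀) →
              ∃ S : Finset ℕ, (∀ M ∈ S, M₀ ≤ M) ∧
                ∀ q : unitInterval, (p : ℝ) / 2 ≤ q → (q : ℝ) ≤ p →
                  (∀ i ∈ Skel.inputIndex Φ S, 1 - δin < (bondPercolation G q).real (Skel.inputEvent Φ hC msel i)) →
                  Φ.toPlanarSkeleton.CylSubcritical q →
                    ∃ (C : PCells) (Λ : ConcRadiiG), Skel.WFS C Λ ∧ K₀ ≤ C.K ∧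
                      Skel.RootOblT G (concSchemeSG Φ C t Λ q δ) Φ.Δ δr ∧
                      Skel.FaceOblR Φ (concSchemeSG Φ C t Λ q δ) (Skel.faceDataSG Φ C t Λ) Φ.Δ δ₂ ∧
                      Skel.ReachOblRH G (concSchemeSG Φ C t Λ q δ) (Skel.faceDataSG Φ C t Λ) Φ.Δ δ) :
    SamePDropOfSkeletonConcLt := by
  refine samePDropOfSkeletonConcLt_of_concSG_inputs fun {V} _ _ G _ Φ hc t ht h0 p hp1 hU hC hθ => ?_
  -- the p-free constants (`Φ.Δ` is the degree parameter; one chain accuracy for every corridor-chain length `≤ nmaxC`)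
  have hε' : (0 : ℝ) < (1 / 2) ^ 35 := by positivity
  -- the corridor-chain accuracy `δ := δC Φ 2⁻³⁵`, packaged with its chain properties so that it stays opaque below
  obtain ⟨δ, hδ0, hδ1, hchainH⟩ : ∃ δ : ℝ, 0 < δ ∧ δ ≤ 1 ∧ ∀ n ≤ Skel.nmaxC, ∀ (q : unitInterval), (q : ℝ) < 1 →
      ∀ (G' : SimpleGraph V) [G'.LocallyFinite], G' ≤ G →
        ∀ (Wt : Sym2 V → unitInterval) (s : Fin (n + 1) → TStep G') (T' : Fin (n + 1) → Finset V) (η : ℝ),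
        (∀ i : Fin (n + 1), (s i).L.o = (s 0).L.o) →
        (∀ i : Fin n, T' (Fin.castSucc i) ⊆ (s i.succ).L.X 0) →
        (∀ i : Fin (n + 1), T' i ⊆ (s i).T) →
        (∀ i : Fin (n + 1), (s i).KitsAt Wt q Φ.Δ δ) →
        η ≤ δ / 2 →
        (∀ i : Fin (n + 1), (prodBernoulli Wt).real (⋃ t ∈ (s i).T \ T' i, openConn (s 0).L.o t) ≤ η) →
        1 - δ < (prodBernoulli Wt).real (s 0).L.reachB →
          1 - (1 / 2 : ℝ) ^ 35 < (prodBernoulli Wt).real (⋃ t ∈ T' (Fin.last n), openConn (s 0).L.o t) :=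
    ⟨δC Φ ((1 / 2) ^ 35), δC_pos Φ _, δC_le_one Φ _, fun n hn q hq1 G' _ hG' => δC_spec Φ hε' hn hq1 G' hG'⟩
  obtain ⟨δ₂, hδ₂0, hδ₂1, hstep⟩ := Φ.apply_step_UP (half_pos hδ0)
  have hrc := fun n : ℕ => Φ.chain_edge_UP n hδ0
  choose δr hδr0 hδr1 hchainr using hrc
  obtain ⟨K₀, hK₀⟩ := exists_pow_lt_of_lt_one hε' (show 1 - δ₂ < 1 by linarith)
  have hp0 : 0 < (p : ℝ) := pos_of_theta_pos G t hθ
  -- the instance at `p`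
  obtain ⟨δin, m₀, hδin, hS⟩ := hres K₀ δ δ₂ δr hδ0 hδ1 hδ₂0 hδ₂1 (fun n => ⟨hδr0 n, hδr1 n⟩) G Φ hc t ht h0 p hp0 hp1 hC
  -- Step I at `p`: the inputs hold (`Skel.exists_inputs_at_p`)
  obtain ⟨msel, M₀, hmsel, hstd⟩ := Skel.exists_inputs_at_p Φ hp1 hθ hC hU hδin m₀
  obtain ⟨S, hSM, hB⟩ := hS msel M₀ hmsel
  -- (A): the input family
  refine ⟨V × ℕ × Option (HOct 2), Skel.inputIndex Φ S, Skel.inputEvent Φ hC msel, Skel.inputEdges Φ hC, fun _ => 1 - δin,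
    fun i _ => Skel.determinedBy_inputEvent Φ hC msel i, hstd S hSM, fun q hq1 hq2 hcq hCq => ?_⟩
  -- (B) at `q`
  have hq1' : (q : ℝ) < 1 := lt_of_le_of_lt hq2 hp1
  obtain ⟨C, Λ, hΛ, hK, hroot, hfaceO, hreachO⟩ := hB q hq1 hq2 hcq hCq
  refine ⟨C, Λ, δ, (1 / 2) ^ 35, δ₂, hΛ, hδ1, hε'.le, hδ₂1, ?_, ?_⟩
  · -- `4((1-δ₂)^K + 2⁻³⁵) ≤ 2⁻³²` since `K ≥ K₀`
    have hKpow : (1 - δ₂) ^ C.K ≤ (1 / 2 : ℝ) ^ 35 :=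
      (pow_le_pow_of_le_one (by linarith) (by linarith) hK).trans hK₀.le
    have h32 : (4 : ℝ) * ((1 / 2) ^ 35 + (1 / 2) ^ 35) = (1 / 2) ^ 32 := by norm_num
    show 4 * ((1 - δ₂) ^ C.K + (1 / 2 : ℝ) ^ 35) ≤ (1 / 2) ^ 32
    linarith
  · exact Skel.kitAtRun_of_oblRH (S := concSchemeSG Φ C t Λ q δ) le_rfl
      (fun c Rπ => hstep q hq1' (Skel.winGraph G c Rπ) (Skel.winGraph_le G c Rπ))
      (fun n hn Ω => hchainH n hn q hq1' (Skel.winGraphIn G Ω) (Skel.winGraphIn_le G Ω))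
      (fun n c Rπ => hchainr n q hq1' (Skel.winGraph G c Rπ) (Skel.winGraph_le G c Rπ)) hroot hfaceO hreachO

end SkelConc

end Transplant

end Summit.CriticalPhenomena.PercolationContinuityZ3.Theorems

end
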